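import Summits.QuantumFields.YangMills.Theorems.BalabanUVNodesN11AllLargeFieldLabel
import Summits.QuantumFields.YangMills.Theorems.BalabanUVNodesN20ChiSemanticsCubes

/-!
# DAG node N11 — THE UNIT BRANCH AT ROUGH DATA: at EVERY Stage-13 witness whose (2.12) regularity threshold `εreg` lies in [B7] Prop. 2's range, a coarse
# field that is `2εreg`-ROUGH NEAR EVERY χ₁-CUBE admits NO (2.12) minimiser of record on any cube, so def-R's localized backgrounds (2.16) are the UNIT
# default everywhere and the field is ALL-(3.2)-SMALL; hence `TLaw₁₃ θ p 0` forces `dU{U cube-rough, Ū cube-rough} = 0` — backgrounds, weights and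
# residuals ALL eliminated from the first instance of K1‴'s N11 conjunct

Cell `pub-ymgap`, YM-PLAN Track A (HUMAN RULING D-0062), seat `pub-ymgap-dag-n11-d` (g5; R134 fan-out seat N11 [B14], strategy s2), item K1‴ `StabilityBAtRecordR13e`
= stmt-QuantumFields-19910.  [III] = [Balaban1988Convergent], [B7] = [Balaban1985Averaging].  Sequel of this seat's `…AllLargeFieldLabel` (p503347: under
`TLaw₁₃ θ p 0`, on the rough coarse fields at which every χ₁-cube is (3.2)-small, `avgDensity = 0 ∨ avgKernel(cube-rough) = 0` a.e.) over seat dag-n20-c's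
`…N20ChiSemantics(Cubes)` (the (2.16) problem of record is solvable only at locally regular data: `dist1_plaqHol_lt_of_solvable`; off the solvable set the
local background is the unit configuration and its small-field factor is `1`: `chiSmall_ukBox_eq_one_of_not_solvable`; the cube cover `pts_cubeEnl_subset`).

WHAT THIS FILE PROVES (0 `sorry`, 0 `def`, standard axioms; `N`-generic).
* §1 `chiFactor_zero_eq_one_of_roughAt` — for numerics `ν` with `0 < εreg`, `C₀(d)·εreg ≤ ⅓`, `2εreg ≤ 2δ_N∕((d+4)L)²` and the grid condition
  `3·L·M₁ ≤ sideχ` (`1 ≤ M₁`, `1 ≤ m + K`, `0 < ε₁η₁²`): if a plaquette `p′` of `T^{(1)}` cornered in `pts 1 (□′^{∼3})` has `dist1 (V₁(∂p′)) ≥ 2εreg`, then the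
  (3.2) factor of the χ₁-cube `□′` at `V₁` is `1` — EITHER the (2.16) problem on `□′^{∼4}` is solvable, and then `V₁` would be `2εreg`-small at `p′` (n20-c), OR it
  is not, and def-R's `UminOfRecord` returns the unit configuration whose factor is `1`.  `forall_chiFactor_zero_eq_one_of_cubeRoughCoarse`: a coarse field
  `2εreg`-rough near every cube is ALL-(3.2)-SMALL.
* §2 AT A STAGE-13 WITNESS `θ` with `θ.ν.εreg` in that range: **`fieldMeasure_cubeRough_inter_preimage_eq_zero_of_slotsT_ae_zero`** — if the
  all-large-field pre-𝐑 slot vanishes a.e. on the `2εreg(Lη₁)²`-rough coarse fields (the conclusion of `…RoughFibre` under `TLaw₁₃ θ p 0` with `α₀ := εreg`), then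
  for every measurable set `R` of cube-rough fine fields (a plaquette with `dist1 ≥ ε₁η₁² + 4·(2δ₀)` inside every `□′^∼`) and the (measurable) set `S` of coarse
  fields with a `2εreg`-rough cornered plaquette near every cube, `dU{U ∈ R, Ū ∈ S} = 0`; the `TLaw₁₃` faces for any `Zt` (12a's measurability ∕ bound displayed)
  and for `Zt = ZtOfRecord`.

READING.  At such witnesses the typed (S1ᵀ)₁₃ can survive its first step ONLY IF almost no cube-rough fine field has a cube-rough block average — an event
defined by plaquette thresholds of `U` and `Ū` alone.  Its Haar-positivity (the pull-back `Q^{s*}V` of a cube-rough coarse `V` lies in it; the averaging of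
record is continuous near `Q^{s*}V`) is NOT proved here; with it, `TLaw₁₃ θ p 0` would be FALSE at every such `θ` on every torus with `K ≥ 1`.  The witness of
record `theta13LiveOfRecord` has `εreg = 1`, outside the range: there the branch of `UminOfRecord` at rough data is not decided by the tree.

HONEST FRAMING.  Count-neutral kernel bookkeeping; necessary conditions of the typed (S1ᵀ)₁₃ at its first step; nothing of Bałaban's asserted or refuted
([15] Thm 1 not used; print never poses (2.12) at rough data); N11 ∕ K1‴ NOT discharged ∕ refuted; counts unmoved (typed 28∕28 · discharged 5∕28).  One finite
four-torus at fixed `ε = L^{−K}`; NOT ℝ⁴ ∕ OS ∕ mass gap ∕ Clay.  Sources: [III] Theorem p.245, (2.12)–(2.13) pp.256–257, (2.16)–(2.17) p.257, (3.1)–(3.5)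
pp.264–265, (3.25) p.270; [B7] (10) p.19, Prop. 2 (52)–(54) p.26.
-/

noncomputable section

open MeasureTheory ProbabilityTheory
open scoped BigOperators Matrix.Norms.L2Operator ENNReal NNReal

namespace Summit.QuantumFields.YangMills.Theorems.BalabanUVNodesN11NoExpansionUnitBranch

open Literature.MathematicalPhysics.QuantumFieldTheory.Balaban1983to89 T4Continuum Node00 Node00.Tk DagBinding
open Literature.MathematicalPhysics.QuantumFieldTheory.Balaban1983to89.T4AveragingDisintegration (avgKernel avgDensity)
open Literature.MathematicalPhysics.QuantumFieldTheory.Balaban1983to89.ExpMeanLog (deltaSU)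
open B15DeterminingSets (pts IsMinimizer avgFamily)
open B14.Eq213DetSet (Bj maxDomT)
open B14.Eq216Concrete (ukBox)
open Literature.MathematicalPhysics.QuantumFieldTheory.BalabanImbrieJaffe1984to88.BIJ85Eq453GaugeField (qsstarGIter0)
open B14.Eq213MaximalDomains (side)
open GaugeField (plaqHol)
open Summit.QuantumFields.YangMills.BalabanUVNodes.N20ChiSemantics (dist1_plaqHol_lt_of_solvable chiSmall_ukBox_eq_one_of_not_solvable)
open Summit.QuantumFields.YangMills.BalabanUVNodes.N20ChiSemanticsCubes (pts_cubeEnl_subset)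
open Summit.QuantumFields.YangMills.Theorems.BalabanUVNodesN11NoExpansionRoughFibre
  (slotsT_one_ae_zero_on_rough_of_tLaw₁₃ slotsT_one_ae_zero_on_rough_of_tLaw₁₃_of_Zt_eq_ZtOfRecord)
open Summit.QuantumFields.YangMills.Theorems.BalabanUVNodesN11AllLargeFieldLabel
  (avgDensity_zero_or_avgKernel_zero_ae_on_allSmall_of_slotsT_ae_zero fieldMeasure_inter_preimage_eq_zero_of_ae)

variable {F : T4Family} {N : ℕ} [NeZero N]

/-! ## §1. The unit branch at rough data: a coarse field rough near a χ₁-cube has (3.2) factor `1` there -/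

section UnitBranch

variable (ν : Stage7Numerics) (p : B12.RunParams) (g : ℕ → ℝ)

/-- **ROUGH NEAR `□′` ⇒ THE (3.2) FACTOR OF `□′` IS `1`** (first step; `εreg` in [B7] Prop. 2's range, grid condition `3·L·M₁ ≤ sideχ`, `1 ≤ M₁`, `1 ≤ m + K`,
`0 < ε₁η₁²`): a level-1 plaquette `p′` cornered in `pts 1 (□′^{∼3})` with `dist1 (V₁(∂p′)) ≥ 2εreg` rules out every (2.12) minimiser of record on `□′^{∼4}`
(n20-c's `dist1_plaqHol_lt_of_solvable`), so def-R's localized background (2.16) is the UNIT configuration and its small-field factor is `1`.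
[cite: Balaban1988Convergent, (2.12)–(2.13) pp.256–257, (2.16)–(2.17) p.257, (3.2) p.265; Balaban1985Averaging, Prop. 2 (52)–(54) p.26] -/
theorem chiFactor_zero_eq_one_of_roughAt (hmK : 1 ≤ (F.P p.K).m + (F.P p.K).K) (hε : 0 < ν.εreg)
    (hε3 : (143 * (((((F.P p.K).d + 4 : ℕ) : ℝ)) ^ 2 / 4) ^ 2) * ν.εreg ≤ 1 / 3)
    (hε2 : 2 * ν.εreg ≤ 2 * deltaSU (Fin N) / ((((F.P p.K).d + 4) * (F.P p.K).L : ℕ) : ℝ) ^ 2)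
    (hM : 1 ≤ ν.M₁) (h3 : 3 * side (F.P p.K).L ν.M₁ 1 ≤ sideχ F ν p g 0)
    (hε₁ : 0 < epsOfRecord ν g 1 * (F.P p.K).eta 1 ^ 2)
    (c : Iχ F ν p g 0) (V1 : GaugeField (F.P p.K) 1 (SU N)) {q : Plaq (F.P p.K) 1}
    (h₀ : q.src ∈ pts 1 (cubeEnl (F.P p.K) (sideχ F ν p g 0) c 3)) (hμ : q.src.shift q.μ ∈ pts 1 (cubeEnl (F.P p.K) (sideχ F ν p g 0) c 3))
    (hν : q.src.shift q.ν ∈ pts 1 (cubeEnl (F.P p.K) (sideχ F ν p g 0) c 3)) (hrough : 2 * ν.εreg ≤ dist1 (plaqHol V1 q)) :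
    chiFactor F N ν p g 0 c V1 = 1 := by
  have hsub := pts_cubeEnl_subset (F.P p.K) hM (k := 1) h3 (c : B14DomainGeom.Pt (F.P p.K).d) 3
  by_cases hsolv : ∃ U₀, IsMinimizer (avOfRecord F N p.K) {U | PlaqSmall (ν.εreg * (F.P p.K).eta 1 ^ 2) U}
      (Bj ν.M₁ (cubeEnl (F.P p.K) (sideχ F ν p g 0) c 4) 1) (avgFamily (avOfRecord F N p.K) (qsstarGIter0 1 V1)) U₀
  · have hlt := dist1_plaqHol_lt_of_solvable (F := F) (N := N) hmK hε hε3 hε2 hsolv q (hsub h₀) (hsub hμ) (hsub hν)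
    exact absurd hlt (not_lt.2 hrough)
  · exact chiSmall_ukBox_eq_one_of_not_solvable _ hε₁ hsolv

/-- **A COARSE FIELD `2εreg`-ROUGH NEAR EVERY χ₁-CUBE IS ALL-(3.2)-SMALL** (same standing hypotheses). [cite: Balaban1988Convergent, (2.12) p.256, (2.16)–(2.17) p.257, (3.2) p.265; Balaban1985Averaging, Prop. 2 (54) p.26] -/
theorem forall_chiFactor_zero_eq_one_of_cubeRoughCoarse (hmK : 1 ≤ (F.P p.K).m + (F.P p.K).K) (hε : 0 < ν.εreg)
    (hε3 : (143 * (((((F.P p.K).d + 4 : ℕ) : ℝ)) ^ 2 / 4) ^ 2) * ν.εreg ≤ 1 / 3)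
    (hε2 : 2 * ν.εreg ≤ 2 * deltaSU (Fin N) / ((((F.P p.K).d + 4) * (F.P p.K).L : ℕ) : ℝ) ^ 2)
    (hM : 1 ≤ ν.M₁) (h3 : 3 * side (F.P p.K).L ν.M₁ 1 ≤ sideχ F ν p g 0)
    (hε₁ : 0 < epsOfRecord ν g 1 * (F.P p.K).eta 1 ^ 2) (V1 : GaugeField (F.P p.K) 1 (SU N))
    (hV : ∀ c : Iχ F ν p g 0, ∃ q : Plaq (F.P p.K) 1,
      q.src ∈ pts 1 (cubeEnl (F.P p.K) (sideχ F ν p g 0) c 3) ∧ q.src.shift q.μ ∈ pts 1 (cubeEnl (F.P p.K) (sideχ F ν p g 0) c 3) ∧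
        q.src.shift q.ν ∈ pts 1 (cubeEnl (F.P p.K) (sideχ F ν p g 0) c 3) ∧ 2 * ν.εreg ≤ dist1 (plaqHol V1 q)) :
    ∀ c : Iχ F ν p g 0, chiFactor F N ν p g 0 c V1 = 1 := fun c => by
  obtain ⟨q, h₀, hμ, hν, hr⟩ := hV c
  exact chiFactor_zero_eq_one_of_roughAt ν p g hmK hε hε3 hε2 hM h3 hε₁ c V1 h₀ hμ hν hr

/-- A coarse field with a `2εreg`-rough plaquette is not `2εreg·(L¹η₁)²`-plaquette-small (`L·η₁ = 1`). [cite: Balaban1985Averaging, Prop. 2 (54) p.26 (bookkeeping)] -/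
theorem not_plaqSmall_of_rough (V1 : GaugeField (F.P p.K) 1 (SU N)) {q : Plaq (F.P p.K) 1} (hrough : 2 * ν.εreg ≤ dist1 (plaqHol V1 q)) :
    ¬ PlaqSmall (2 * ν.εreg * (((F.P p.K).L : ℝ) ^ 1 * (F.P p.K).eta 1) ^ 2) V1 := by
  intro h
  have hL : ((F.P p.K).L : ℝ) ≠ 0 := by exact_mod_cast (F.P p.K).L_pos.ne'
  have h1 : ((F.P p.K).L : ℝ) ^ 1 * (F.P p.K).eta 1 = 1 := by
    rw [Params.eta, pow_one, pow_one, mul_inv_cancel₀ hL]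
  have hq := h q
  rw [h1, one_pow, mul_one] at hq
  exact absurd hq (not_lt.2 hrough)

/-- The set of coarse fields with a `2εreg`-rough cornered plaquette near every χ₁-cube is measurable (finitely many closed plaquette conditions).
[cite: Balaban1985Averaging, (9) p.19 (bookkeeping)] -/
theorem measurableSet_cubeRoughCoarse :
    MeasurableSet {V1 : GaugeField (F.P p.K) 1 (SU N) | ∀ c : Iχ F ν p g 0, ∃ q : Plaq (F.P p.K) 1,
      q.src ∈ pts 1 (cubeEnl (F.P p.K) (sideχ F ν p g 0) c 3) ∧ q.src.shift q.μ ∈ pts 1 (cubeEnl (F.P p.K) (sideχ F ν p g 0) c 3) ∧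
        q.src.shift q.ν ∈ pts 1 (cubeEnl (F.P p.K) (sideχ F ν p g 0) c 3) ∧ 2 * ν.εreg ≤ dist1 (plaqHol V1 q)} := by
  have h : {V1 : GaugeField (F.P p.K) 1 (SU N) | ∀ c : Iχ F ν p g 0, ∃ q : Plaq (F.P p.K) 1,
      q.src ∈ pts 1 (cubeEnl (F.P p.K) (sideχ F ν p g 0) c 3) ∧ q.src.shift q.μ ∈ pts 1 (cubeEnl (F.P p.K) (sideχ F ν p g 0) c 3) ∧
        q.src.shift q.ν ∈ pts 1 (cubeEnl (F.P p.K) (sideχ F ν p g 0) c 3) ∧ 2 * ν.εreg ≤ dist1 (plaqHol V1 q)} =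
      ⋂ c : Iχ F ν p g 0, ⋃ q : Plaq (F.P p.K) 1, {V1 : GaugeField (F.P p.K) 1 (SU N) |
        q.src ∈ pts 1 (cubeEnl (F.P p.K) (sideχ F ν p g 0) c 3) ∧ q.src.shift q.μ ∈ pts 1 (cubeEnl (F.P p.K) (sideχ F ν p g 0) c 3) ∧
          q.src.shift q.ν ∈ pts 1 (cubeEnl (F.P p.K) (sideχ F ν p g 0) c 3) ∧ 2 * ν.εreg ≤ dist1 (plaqHol V1 q)} := by
    ext V1; simp only [Set.mem_setOf_eq, Set.mem_iInter, Set.mem_iUnion]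
  rw [h]
  refine MeasurableSet.iInter fun c => MeasurableSet.iUnion fun q => ?_
  by_cases hq : q.src ∈ pts 1 (cubeEnl (F.P p.K) (sideχ F ν p g 0) c 3) ∧ q.src.shift q.μ ∈ pts 1 (cubeEnl (F.P p.K) (sideχ F ν p g 0) c 3) ∧
      q.src.shift q.ν ∈ pts 1 (cubeEnl (F.P p.K) (sideχ F ν p g 0) c 3)
  · have hset : {V1 : GaugeField (F.P p.K) 1 (SU N) |
        q.src ∈ pts 1 (cubeEnl (F.P p.K) (sideχ F ν p g 0) c 3) ∧ q.src.shift q.μ ∈ pts 1 (cubeEnl (F.P p.K) (sideχ F ν p g 0) c 3) ∧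
          q.src.shift q.ν ∈ pts 1 (cubeEnl (F.P p.K) (sideχ F ν p g 0) c 3) ∧ 2 * ν.εreg ≤ dist1 (plaqHol V1 q)} =
        {V1 : GaugeField (F.P p.K) 1 (SU N) | 2 * ν.εreg ≤ dist1 (plaqHol V1 q)} := by
      ext V1; simp only [Set.mem_setOf_eq, hq, true_and]
    rw [hset]
    exact measurableSet_le measurable_const (RegularGaugeGroup.measurable_dist1.comp (Missing.measurable_plaqHol q))
  · have hset : {V1 : GaugeField (F.P p.K) 1 (SU N) |
        q.src ∈ pts 1 (cubeEnl (F.P p.K) (sideχ F ν p g 0) c 3) ∧ q.src.shift q.μ ∈ pts 1 (cubeEnl (F.P p.K) (sideχ F ν p g 0) c 3) ∧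
          q.src.shift q.ν ∈ pts 1 (cubeEnl (F.P p.K) (sideχ F ν p g 0) c 3) ∧ 2 * ν.εreg ≤ dist1 (plaqHol V1 q)} = ∅ := by
      ext V1
      simp only [Set.mem_setOf_eq, Set.mem_empty_iff_false, iff_false]
      exact fun h' => hq ⟨h'.1, h'.2.1, h'.2.2.1⟩
    rw [hset]
    exact MeasurableSet.empty

end UnitBranch

/-! ## §2. At a Stage-13 witness with `εreg` in [B7] Prop. 2's range: `dU{U cube-rough, Ū cube-rough} = 0` under a.e. vanishing of the slot -/

section AtWitness

variable (θ : Stage13Params F N) (p : B12.RunParams)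

/-- **IF THE ALL-LARGE-FIELD SLOT VANISHES a.e. ON THE `2εreg`-ROUGH COARSE FIELDS, THEN `dU{U ∈ R, Ū ∈ S} = 0`** for every measurable set `R` of
cube-rough fine fields and `S` = the coarse fields with a `2εreg`-rough cornered plaquette near every χ₁-cube (`εreg` in [B7] Prop. 2's range; ζ-unity;
`0 <` the cube sides; grid condition; `1 ≤ m + K`; `0 < ε₁η₁²`; `0 < K`). [cite: Balaban1988Convergent, (2.12) p.256, (2.16)–(2.17) p.257, (3.1)–(3.5) pp.264–265, (3.25) p.270; Balaban1985Averaging, (10) p.19, Prop. 2 (54) p.26] -/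
theorem fieldMeasure_cubeRough_inter_preimage_eq_zero_of_slotsT_ae_zero (hζ : IsZetaUnity F N θ.ν θ.τ9.M θ.ζ)
    (hD : 0 < sideD F θ.ν θ.τ9.M p (gOfRecord₁₃ F N θ p) 0) (hχ : 0 < sideχ F θ.ν p (gOfRecord₁₃ F N θ p) 0) (hK : 0 < p.K)
    (hmK : 1 ≤ (F.P p.K).m + (F.P p.K).K) (hε : 0 < θ.ν.εreg)
    (hε3 : (143 * (((((F.P p.K).d + 4 : ℕ) : ℝ)) ^ 2 / 4) ^ 2) * θ.ν.εreg ≤ 1 / 3)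
    (hε2 : 2 * θ.ν.εreg ≤ 2 * deltaSU (Fin N) / ((((F.P p.K).d + 4) * (F.P p.K).L : ℕ) : ℝ) ^ 2)
    (hM : 1 ≤ θ.ν.M₁) (h3 : 3 * side (F.P p.K).L θ.ν.M₁ 1 ≤ sideχ F θ.ν p (gOfRecord₁₃ F N θ p) 0)
    (hε₁ : 0 < epsOfRecord θ.ν (gOfRecord₁₃ F N θ p) 1 * (F.P p.K).eta 1 ^ 2)
    (s : SeqOfRecord F θ.ν θ.τ9.M (gOfRecord₁₃ F N θ p) p.K 1) (hΩ : s.Ω 1 = ∅)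
    (hvan : ∀ᵐ V1 ∂fieldMeasure (F.P p.K) 1 (SU N), ¬ PlaqSmall (2 * θ.ν.εreg * (((F.P p.K).L : ℝ) ^ 1 * (F.P p.K).eta 1) ^ 2) V1 →
      slotsTOfRecord F N θ.ν θ.τ9 (EOfRecord₁₃ F N θ) (wOfRecord₉ F N θ.toStage9Params) θ.ppSel p (gOfRecord₁₃ F N θ p) 1 s V1 = 0)
    {R : Set (GaugeField (F.P p.K) 0 (SU N))} (hRm : MeasurableSet R)
    (hR : ∀ U ∈ R, ∀ c : Iχ F θ.ν p (gOfRecord₁₃ F N θ p) 0,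
      ∃ q ∈ plaqInside (cubeEnl (F.P p.K) (sideχ F θ.ν p (gOfRecord₁₃ F N θ p) 0) c 1),
        epsOfRecord θ.ν (gOfRecord₁₃ F N θ p) 1 * (F.P p.K).eta 1 ^ 2 + 4 * (2 * deltaOfRecord θ.ν (gOfRecord₁₃ F N θ p) 0 θ.A₁) ≤
          dist1 (plaqHol U q)) :
    fieldMeasure (F.P p.K) 0 (SU N) (R ∩ (avOfRecord F N p.K 0).avg ⁻¹'
      {V1 : GaugeField (F.P p.K) 1 (SU N) | ∀ c : Iχ F θ.ν p (gOfRecord₁₃ F N θ p) 0, ∃ q : Plaq (F.P p.K) 1,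
        q.src ∈ pts 1 (cubeEnl (F.P p.K) (sideχ F θ.ν p (gOfRecord₁₃ F N θ p) 0) c 3) ∧
          q.src.shift q.μ ∈ pts 1 (cubeEnl (F.P p.K) (sideχ F θ.ν p (gOfRecord₁₃ F N θ p) 0) c 3) ∧
          q.src.shift q.ν ∈ pts 1 (cubeEnl (F.P p.K) (sideχ F θ.ν p (gOfRecord₁₃ F N θ p) 0) c 3) ∧
          2 * θ.ν.εreg ≤ dist1 (plaqHol V1 q)}) = 0 := by
  haveI : Nonempty (Iχ F θ.ν p (gOfRecord₁₃ F N θ p) 0) := by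
    by_contra hne
    rw [not_nonempty_iff] at hne
    have huniv := cubesχ_univ F θ.ν p (gOfRecord₁₃ F N θ p) 0 hχ
    have hx : (fun _ => (0 : ZMod ((F.P p.K).sitesPerDir 0)) : Site (F.P p.K) 0) ∈
        cubesχ F θ.ν p (gOfRecord₁₃ F N θ p) 0 (Finset.univ : Finset (Iχ F θ.ν p (gOfRecord₁₃ F N θ p) 0)) := by
      rw [huniv]; exact Set.mem_univ _
    simp only [cubesχ] at hx
    obtain ⟨c, -⟩ := Set.mem_iUnion.1 hx
    exact hne.elim c
  refine fieldMeasure_inter_preimage_eq_zero_of_ae p hK hRm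
    (Ro := fun V1 => ¬ PlaqSmall (2 * θ.ν.εreg * (((F.P p.K).L : ℝ) ^ 1 * (F.P p.K).eta 1) ^ 2) V1)
    (A := fun V1 => ∀ c : Iχ F θ.ν p (gOfRecord₁₃ F N θ p) 0, chiFactor F N θ.ν p (gOfRecord₁₃ F N θ p) 0 c V1 = 1)
    (avgDensity_zero_or_avgKernel_zero_ae_on_allSmall_of_slotsT_ae_zero θ p hζ hD hχ s hΩ hRm hR hvan)
    (measurableSet_cubeRoughCoarse θ.ν p _) (fun V1 hV1 => ?_) (fun V1 hV1 => ?_)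
  · obtain ⟨q, -, -, -, hr⟩ := hV1 (Classical.arbitrary _)
    exact not_plaqSmall_of_rough θ.ν p V1 hr
  · exact forall_chiFactor_zero_eq_one_of_cubeRoughCoarse θ.ν p _ hmK hε hε3 hε2 hM h3 hε₁ V1 hV1

/-- **UNDER `TLaw₁₃ θ p 0` (any `θ.Zt`: 12a's measurability ∕ bound displayed; junction at `α₀ := εreg`, `M ≥ 1`)** the hypothesis `hvan` is this seat's
`…RoughFibre.slotsT_one_ae_zero_on_rough_of_tLaw₁₃` with `α₀ := εreg`: so `dU{U ∈ R, Ū ∈ S} = 0`. [cite: Balaban1988Convergent, Theorem p.245, (3.25) p.270, (2.10)–(2.12) p.256; Balaban1985Averaging, Prop. 2 (53)–(54) p.26] -/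
theorem fieldMeasure_cubeRough_inter_preimage_eq_zero_of_tLaw₁₃ (hζ : IsZetaUnity F N θ.ν θ.τ9.M θ.ζ)
    (hD : 0 < sideD F θ.ν θ.τ9.M p (gOfRecord₁₃ F N θ p) 0) (hχ : 0 < sideχ F θ.ν p (gOfRecord₁₃ F N θ p) 0) (hK : 0 < p.K)
    (hmK : 1 ≤ (F.P p.K).m + (F.P p.K).K) (hε : 0 < θ.ν.εreg)
    (hε3 : (143 * (((((F.P p.K).d + 4 : ℕ) : ℝ)) ^ 2 / 4) ^ 2) * θ.ν.εreg ≤ 1 / 3)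
    (hε2 : 2 * θ.ν.εreg ≤ 2 * deltaSU (Fin N) / ((((F.P p.K).d + 4) * (F.P p.K).L : ℕ) : ℝ) ^ 2)
    (hM : 1 ≤ θ.ν.M₁) (h3 : 3 * side (F.P p.K).L θ.ν.M₁ 1 ≤ sideχ F θ.ν p (gOfRecord₁₃ F N θ p) 0)
    (hε₁ : 0 < epsOfRecord θ.ν (gOfRecord₁₃ F N θ p) 1 * (F.P p.K).eta 1 ^ 2)
    (hc : θ.s2.cR * epsOfRecord θ.ν (gOfRecord₁₃ F N θ p) 0 ≤ θ.ν.εreg * (F.P p.K).eta 0 ^ 2) (hMτ : 1 ≤ θ.τ9.M)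
    (hαε : θ.s2.cR * epsOfRecord θ.ν (gOfRecord₁₃ F N θ p) 0 ≤ θ.ν.εreg * (F.P p.K).eta 1 ^ 2)
    (s : SeqOfRecord F θ.ν θ.τ9.M (gOfRecord₁₃ F N θ p) p.K 1) (hΩ : s.Ω 1 = ∅) (hT : TLaw₁₃ F N θ p 0)
    {C : ℝ}
    (hm : Measurable (Function.uncurry fun (V1 : GaugeField (F.P p.K) 1 (SU N)) (Uf : GaugeField (F.P p.K) 0 (SU N)) =>
      (θ.Zt p.K).ζ0 0 Set.univ (pairCfg V1 Uf) *
          chiRegW F N (FluctV N) θ.ν θ.s2.cR p (gOfRecord₁₃ F N θ p) 0 Set.univ (pairCfg (V := FluctV N) V1 Uf) *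
        (Real.exp (-(1 / 2 : ℝ) * (θ.Zt p.K).quad 0 ∅ (pairCfg V1 Uf)) * rhoZeroOfRecord F N p.K p.g0 (EOfRecord₁₃ F N θ p) Uf)))
    (hC : ∀ (V1 : GaugeField (F.P p.K) 1 (SU N)) (Uf : GaugeField (F.P p.K) 0 (SU N)),
      |(θ.Zt p.K).ζ0 0 Set.univ (pairCfg V1 Uf) *
          chiRegW F N (FluctV N) θ.ν θ.s2.cR p (gOfRecord₁₃ F N θ p) 0 Set.univ (pairCfg (V := FluctV N) V1 Uf) *
        (Real.exp (-(1 / 2 : ℝ) * (θ.Zt p.K).quad 0 ∅ (pairCfg V1 Uf)) * rhoZeroOfRecord F N p.K p.g0 (EOfRecord₁₃ F N θ p) Uf)| ≤ C)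
    {R : Set (GaugeField (F.P p.K) 0 (SU N))} (hRm : MeasurableSet R)
    (hR : ∀ U ∈ R, ∀ c : Iχ F θ.ν p (gOfRecord₁₃ F N θ p) 0,
      ∃ q ∈ plaqInside (cubeEnl (F.P p.K) (sideχ F θ.ν p (gOfRecord₁₃ F N θ p) 0) c 1),
        epsOfRecord θ.ν (gOfRecord₁₃ F N θ p) 1 * (F.P p.K).eta 1 ^ 2 + 4 * (2 * deltaOfRecord θ.ν (gOfRecord₁₃ F N θ p) 0 θ.A₁) ≤
          dist1 (plaqHol U q)) :
    fieldMeasure (F.P p.K) 0 (SU N) (R ∩ (avOfRecord F N p.K 0).avg ⁻¹'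
      {V1 : GaugeField (F.P p.K) 1 (SU N) | ∀ c : Iχ F θ.ν p (gOfRecord₁₃ F N θ p) 0, ∃ q : Plaq (F.P p.K) 1,
        q.src ∈ pts 1 (cubeEnl (F.P p.K) (sideχ F θ.ν p (gOfRecord₁₃ F N θ p) 0) c 3) ∧
          q.src.shift q.μ ∈ pts 1 (cubeEnl (F.P p.K) (sideχ F θ.ν p (gOfRecord₁₃ F N θ p) 0) c 3) ∧
          q.src.shift q.ν ∈ pts 1 (cubeEnl (F.P p.K) (sideχ F θ.ν p (gOfRecord₁₃ F N θ p) 0) c 3) ∧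
          2 * θ.ν.εreg ≤ dist1 (plaqHol V1 q)}) = 0 :=
  fieldMeasure_cubeRough_inter_preimage_eq_zero_of_slotsT_ae_zero θ p hζ hD hχ hK hmK hε hε3 hε2 hM h3 hε₁ s hΩ
    (slotsT_one_ae_zero_on_rough_of_tLaw₁₃ θ p hc hMτ hK s hΩ hT hε hε3 hε2 hαε hm hC) hRm hR

/-- **THE SAME AT A `θ` WITH `θ.Zt = ZtOfRecord`** (12a's displayed measurability ∕ bound discharged).
[cite: Balaban1988Convergent, Theorem p.245, (3.25) p.270, (2.10)–(2.12) p.256; Balaban1985Averaging, Prop. 2 (53)–(54) p.26] -/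
theorem fieldMeasure_cubeRough_inter_preimage_eq_zero_of_tLaw₁₃_of_Zt_eq_ZtOfRecord (hZt : θ.Zt = ZtOfRecord F N)
    (hζ : IsZetaUnity F N θ.ν θ.τ9.M θ.ζ)
    (hD : 0 < sideD F θ.ν θ.τ9.M p (gOfRecord₁₃ F N θ p) 0) (hχ : 0 < sideχ F θ.ν p (gOfRecord₁₃ F N θ p) 0) (hK : 0 < p.K)
    (hmK : 1 ≤ (F.P p.K).m + (F.P p.K).K) (hε : 0 < θ.ν.εreg)
    (hε3 : (143 * (((((F.P p.K).d + 4 : ℕ) : ℝ)) ^ 2 / 4) ^ 2) * θ.ν.εreg ≤ 1 / 3)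
    (hε2 : 2 * θ.ν.εreg ≤ 2 * deltaSU (Fin N) / ((((F.P p.K).d + 4) * (F.P p.K).L : ℕ) : ℝ) ^ 2)
    (hM : 1 ≤ θ.ν.M₁) (h3 : 3 * side (F.P p.K).L θ.ν.M₁ 1 ≤ sideχ F θ.ν p (gOfRecord₁₃ F N θ p) 0)
    (hε₁ : 0 < epsOfRecord θ.ν (gOfRecord₁₃ F N θ p) 1 * (F.P p.K).eta 1 ^ 2)
    (hc : θ.s2.cR * epsOfRecord θ.ν (gOfRecord₁₃ F N θ p) 0 ≤ θ.ν.εreg * (F.P p.K).eta 0 ^ 2) (hMτ : 1 ≤ θ.τ9.M)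
    (hαε : θ.s2.cR * epsOfRecord θ.ν (gOfRecord₁₃ F N θ p) 0 ≤ θ.ν.εreg * (F.P p.K).eta 1 ^ 2)
    (s : SeqOfRecord F θ.ν θ.τ9.M (gOfRecord₁₃ F N θ p) p.K 1) (hΩ : s.Ω 1 = ∅) (hT : TLaw₁₃ F N θ p 0)
    {R : Set (GaugeField (F.P p.K) 0 (SU N))} (hRm : MeasurableSet R)
    (hR : ∀ U ∈ R, ∀ c : Iχ F θ.ν p (gOfRecord₁₃ F N θ p) 0,
      ∃ q ∈ plaqInside (cubeEnl (F.P p.K) (sideχ F θ.ν p (gOfRecord₁₃ F N θ p) 0) c 1),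
        epsOfRecord θ.ν (gOfRecord₁₃ F N θ p) 1 * (F.P p.K).eta 1 ^ 2 + 4 * (2 * deltaOfRecord θ.ν (gOfRecord₁₃ F N θ p) 0 θ.A₁) ≤
          dist1 (plaqHol U q)) :
    fieldMeasure (F.P p.K) 0 (SU N) (R ∩ (avOfRecord F N p.K 0).avg ⁻¹'
      {V1 : GaugeField (F.P p.K) 1 (SU N) | ∀ c : Iχ F θ.ν p (gOfRecord₁₃ F N θ p) 0, ∃ q : Plaq (F.P p.K) 1,
        q.src ∈ pts 1 (cubeEnl (F.P p.K) (sideχ F θ.ν p (gOfRecord₁₃ F N θ p) 0) c 3) ∧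
          q.src.shift q.μ ∈ pts 1 (cubeEnl (F.P p.K) (sideχ F θ.ν p (gOfRecord₁₃ F N θ p) 0) c 3) ∧
          q.src.shift q.ν ∈ pts 1 (cubeEnl (F.P p.K) (sideχ F θ.ν p (gOfRecord₁₃ F N θ p) 0) c 3) ∧
          2 * θ.ν.εreg ≤ dist1 (plaqHol V1 q)}) = 0 :=
  fieldMeasure_cubeRough_inter_preimage_eq_zero_of_slotsT_ae_zero θ p hζ hD hχ hK hmK hε hε3 hε2 hM h3 hε₁ s hΩ
    (slotsT_one_ae_zero_on_rough_of_tLaw₁₃_of_Zt_eq_ZtOfRecord θ p hZt hc hMτ hK s hΩ hT hε hε3 hε2 hαε) hRm hR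

end AtWitness

end Summit.QuantumFields.YangMills.Theorems.BalabanUVNodesN11NoExpansionUnitBranch

end
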